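import Summits.RiemannHypothesis.RiemannHypothesis.Theorems.WeilColumnThetaWitness
import Summits.RiemannHypothesis.RiemannHypothesis.Theorems.WeilColumnBSplineContinuity
import HarnessLib

/-!
# The B-spline CDF toolkit (W1 of THETA-ASSIGN): real nonnegative even density of mass one; monotone C¹ CDF with 0/1 plateaus (RH-FREE)

Cell `rh-explicit`, WEIL column, seat handoff-prove-2 gen12 (THETA-ASSIGN v1.0 §3 W1; interface `WeilColumnThetaWitness`, p418783).
For `c > 0`: `bsplineDensity c k` (`WeilColumnBSplineFourier`) is REAL (`= ↑(re ·)`), NONNEGATIVE, EVEN, of total mass `1`, bounded by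
`(2c)⁻¹` (`WeilColumnBSplineContinuity`) and supported in `[−(k+1)c, (k+1)c]`; its CDF
`bsplineCDF c k v = ∫_{Iic v} re(bsplineDensity c k)` is monotone, takes values in `[0,1]`, equals `0` for `v ≤ −(k+1)c` and `1`
for `v ≥ (k+1)c`, satisfies `F(−v) = 1 − F(v)`, and for `k ≥ 1` is C¹ with `F′ = re ρ ∈ [0, (2c)⁻¹]` (FTC) — the facts W2/W3/D4/D8
of the programme need about the cut `P.cut` and the top-layer profile `P.Rtop`.  Nothing here bears on the truth of RH.
-/

noncomputable section

set_option linter.dupNamespace false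

open Complex Set MeasureTheory Filter
open scoped Real Topology

namespace Summit.RiemannHypothesis.RiemannHypothesis.Theorems.WeilColumn.ThetaMellin

open Literature.NumberTheory.LFunctions ThetaParams

variable {c : ℝ}

/-! ## §1 The density: real, nonnegative, even, mass one -/

/-- Unfolding the recursion: `bsplineDensity c (k+1) x = ∫ u, unif_c u · bsplineDensity c k (x − u)`. -/
theorem bsplineDensity_succ_apply (c : ℝ) (k : ℕ) (x : ℝ) :
    bsplineDensity c (k + 1) x = ∫ u, unifDensity c u * bsplineDensity c k (x - u) := by
  rw [show bsplineDensity c (k + 1) = weilConv (unifDensity c) (bsplineDensity c k) from rfl, weilConv_apply]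

/-- The uniform density is real: `unif_c u = ↑(re (unif_c u))`. -/
theorem unifDensity_eq_ofReal_re (c u : ℝ) : unifDensity c u = (((unifDensity c u).re : ℝ) : ℂ) := by
  rw [unifDensity_apply]; split_ifs <;> simp

/-- **Every B-spline density is real-valued**: `bsplineDensity c k t = ↑(re (bsplineDensity c k t))`. [folklore] -/
theorem bsplineDensity_eq_ofReal_re (c : ℝ) : ∀ (k : ℕ) (t : ℝ), bsplineDensity c k t = (((bsplineDensity c k t).re : ℝ) : ℂ)
  | 0, t => unifDensity_eq_ofReal_re c t
  | k + 1, t => by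
      have hfun : (fun u ↦ unifDensity c u * bsplineDensity c k (t - u)) =
          fun u ↦ ((((unifDensity c u).re * (bsplineDensity c k (t - u)).re : ℝ)) : ℂ) := by
        funext u
        conv_lhs => rw [unifDensity_eq_ofReal_re c u, bsplineDensity_eq_ofReal_re c k (t - u)]
        push_cast; ring
      rw [bsplineDensity_succ_apply, hfun, integral_complex_ofReal, Complex.ofReal_re]

/-- The real recursion: `re ρ_{k+1}(t) = ∫ u, re(unif_c u)·re ρ_k(t − u)`. -/
theorem bsplineDensity_succ_re (c : ℝ) (k : ℕ) (t : ℝ) :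
    (bsplineDensity c (k + 1) t).re = ∫ u, (unifDensity c u).re * (bsplineDensity c k (t - u)).re := by
  have hfun : (fun u ↦ unifDensity c u * bsplineDensity c k (t - u)) =
      fun u ↦ ((((unifDensity c u).re * (bsplineDensity c k (t - u)).re : ℝ)) : ℂ) := by
    funext u
    conv_lhs => rw [unifDensity_eq_ofReal_re c u, bsplineDensity_eq_ofReal_re c k (t - u)]
    push_cast; ring
  rw [bsplineDensity_succ_apply, hfun, integral_complex_ofReal, Complex.ofReal_re]

/-- `0 ≤ re(unif_c u)` for `c ≥ 0`. -/
theorem unifDensity_re_nonneg (hc : 0 ≤ c) (u : ℝ) : 0 ≤ (unifDensity c u).re := by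
  rw [unifDensity_apply]; split_ifs
  · rw [Complex.ofReal_re]; positivity
  · simp

/-- **Nonnegativity**: `0 ≤ re(bsplineDensity c k t)` for `c ≥ 0`. [folklore] -/
theorem bsplineDensity_re_nonneg (hc : 0 ≤ c) : ∀ (k : ℕ) (t : ℝ), 0 ≤ (bsplineDensity c k t).re
  | 0, t => unifDensity_re_nonneg hc t
  | k + 1, t => by
      rw [bsplineDensity_succ_re]
      exact integral_nonneg fun u ↦ mul_nonneg (unifDensity_re_nonneg hc u) (bsplineDensity_re_nonneg hc k _)

/-- `re(bsplineDensity c k t) ≤ (2c)⁻¹` for `c > 0`. -/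
theorem bsplineDensity_re_le (hc : 0 < c) (k : ℕ) (t : ℝ) : (bsplineDensity c k t).re ≤ (2 * c)⁻¹ :=
  (Complex.re_le_norm _).trans (norm_bsplineDensity_le hc k t)

/-- The uniform density is even. -/
theorem unifDensity_neg (c u : ℝ) : unifDensity c (-u) = unifDensity c u := by
  rw [unifDensity_apply, unifDensity_apply]
  have : (-u ∈ Icc (-c) c) ↔ (u ∈ Icc (-c) c) := by simp only [mem_Icc]; constructor <;> rintro ⟨h1, h2⟩ <;> constructor <;> linarith
  simp only [this]

/-- **Evenness**: `bsplineDensity c k (−t) = bsplineDensity c k t`. [folklore] -/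
theorem bsplineDensity_neg (c : ℝ) : ∀ (k : ℕ) (t : ℝ), bsplineDensity c k (-t) = bsplineDensity c k t
  | 0, t => unifDensity_neg c t
  | k + 1, t => by
      rw [bsplineDensity_succ_apply, bsplineDensity_succ_apply,
        ← integral_neg_eq_self (fun u ↦ unifDensity c u * bsplineDensity c k (-t - u)) volume]
      refine integral_congr_ae (Eventually.of_forall fun u ↦ ?_)
      simp only
      rw [unifDensity_neg, show -t - -u = -(t - u) by ring, bsplineDensity_neg c k (t - u)]

/-- **Mass one**: `∫ bsplineDensity c k = 1` for `c > 0`. [folklore] -/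
theorem integral_bsplineDensity (hc : 0 < c) : ∀ k : ℕ, ∫ t, bsplineDensity c k t = 1
  | 0 => by
      rw [show bsplineDensity c 0 = unifDensity c from rfl, unifDensity, integral_indicatorConst (by linarith)]
      have hc' : (c : ℂ) ≠ 0 := by exact_mod_cast hc.ne'
      push_cast
      field_simp
      ring
  | k + 1 => by
      rw [show bsplineDensity c (k + 1) = weilConv (unifDensity c) (bsplineDensity c k) from rfl,
        integral_weilConv (integrable_unifDensity c) (integrable_bsplineDensity c k), integral_bsplineDensity hc k, mul_one]
      exact integral_bsplineDensity hc 0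

/-- The real density is integrable. -/
theorem integrable_bsplineDensity_re (c : ℝ) (k : ℕ) : Integrable fun t ↦ (bsplineDensity c k t).re :=
  (integrable_bsplineDensity c k).re

/-- **Mass one, real form**: `∫ re(bsplineDensity c k) = 1` for `c > 0`. -/
theorem integral_bsplineDensity_re (hc : 0 < c) (k : ℕ) : ∫ t, (bsplineDensity c k t).re = 1 := by
  have h := congrArg Complex.re (integral_bsplineDensity hc k)
  have h2 := integral_re (integrable_bsplineDensity c k)
  simp only [RCLike.re_to_complex] at h2
  rw [h2, h, Complex.one_re]

/-- Beyond the support the real density vanishes: `re ρ_k(t) = 0` for `|t| > (k+1)c` (`c ≥ 0`). -/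
theorem bsplineDensity_re_eq_zero (hc : 0 ≤ c) (k : ℕ) {t : ℝ} (ht : t ∉ Icc (-(((k : ℝ) + 1) * c)) (((k : ℝ) + 1) * c)) :
    (bsplineDensity c k t).re = 0 := by
  have h : bsplineDensity c k t = 0 := by
    by_contra hne
    exact ht (support_bsplineDensity_subset hc k (Function.mem_support.2 hne))
  rw [h, Complex.zero_re]

/-! ## §2 The CDF: values in `[0,1]`, monotone, plateaus, symmetry -/

/-- `0 ≤ bsplineCDF c k v` (`c ≥ 0`). -/
theorem bsplineCDF_nonneg (hc : 0 ≤ c) (k : ℕ) (v : ℝ) : 0 ≤ bsplineCDF c k v :=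
  setIntegral_nonneg measurableSet_Iic fun t _ ↦ bsplineDensity_re_nonneg hc k t

/-- `bsplineCDF c k v ≤ 1` (`c > 0`). -/
theorem bsplineCDF_le_one (hc : 0 < c) (k : ℕ) (v : ℝ) : bsplineCDF c k v ≤ 1 := by
  rw [bsplineCDF, ← integral_bsplineDensity_re hc k]
  exact setIntegral_le_integral (integrable_bsplineDensity_re c k)
    (Eventually.of_forall fun t ↦ bsplineDensity_re_nonneg hc.le k t)

/-- **The CDF is monotone** (`c ≥ 0`). -/
theorem bsplineCDF_mono (hc : 0 ≤ c) (k : ℕ) : Monotone (bsplineCDF c k) := by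
  intro v w hvw
  unfold bsplineCDF
  exact setIntegral_mono_set (integrable_bsplineDensity_re c k).integrableOn
    (Eventually.of_forall fun t ↦ bsplineDensity_re_nonneg hc k t) (Eventually.of_forall fun t ht ↦ le_trans ht hvw)

/-- **Lower plateau**: `bsplineCDF c k v = 0` for `v ≤ −(k+1)c` (`c ≥ 0`). -/
theorem bsplineCDF_eq_zero (hc : 0 ≤ c) (k : ℕ) {v : ℝ} (hv : v ≤ -(((k : ℝ) + 1) * c)) : bsplineCDF c k v = 0 := by
  unfold bsplineCDF
  rw [← setIntegral_congr_set Iio_ae_eq_Iic]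
  refine setIntegral_eq_zero_of_forall_eq_zero fun t ht ↦ bsplineDensity_re_eq_zero hc k fun h ↦ ?_
  exact absurd (lt_of_lt_of_le ht hv) (not_lt.2 h.1)

/-- **Upper plateau**: `bsplineCDF c k v = 1` for `v ≥ (k+1)c` (`c > 0`). -/
theorem bsplineCDF_eq_one (hc : 0 < c) (k : ℕ) {v : ℝ} (hv : ((k : ℝ) + 1) * c ≤ v) : bsplineCDF c k v = 1 := by
  unfold bsplineCDF
  have h := integral_add_compl (μ := volume) (measurableSet_Iic (a := v)) (integrable_bsplineDensity_re c k)
  rw [integral_bsplineDensity_re hc k, compl_Iic] at h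
  have h0 : ∫ t in Ioi v, (bsplineDensity c k t).re = 0 := by
    refine setIntegral_eq_zero_of_forall_eq_zero fun t ht ↦ bsplineDensity_re_eq_zero hc.le k fun hm ↦ ?_
    exact absurd (lt_of_le_of_lt hv ht) (not_lt.2 hm.2)
  linarith

/-- **Symmetry**: `bsplineCDF c k (−v) = 1 − bsplineCDF c k v` (`c > 0`; evenness of the density). -/
theorem bsplineCDF_neg (hc : 0 < c) (k : ℕ) (v : ℝ) : bsplineCDF c k (-v) = 1 - bsplineCDF c k v := by
  unfold bsplineCDF
  have heven : (fun t ↦ (bsplineDensity c k t).re) = fun t ↦ (bsplineDensity c k (-t)).re := by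
    funext t; rw [bsplineDensity_neg]
  have h1 : ∫ t in Iic (-v), (bsplineDensity c k t).re = ∫ t in Ioi v, (bsplineDensity c k t).re := by
    conv_lhs => rw [heven]
    rw [integral_comp_neg_Iic (-v) (fun t ↦ (bsplineDensity c k t).re), neg_neg]
  have h := integral_add_compl (μ := volume) (measurableSet_Iic (a := v)) (integrable_bsplineDensity_re c k)
  rw [integral_bsplineDensity_re hc k, compl_Iic] at h
  rw [h1]
  linarith

/-! ## §3 The CDF is C¹ for `k ≥ 1` (FTC), with derivative `re ρ ∈ [0, (2c)⁻¹]` -/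

/-- The real density of order `k ≥ 1` is continuous (`c > 0`). -/
theorem continuous_bsplineDensity_re (hc : 0 < c) {k : ℕ} (hk : 1 ≤ k) :
    Continuous fun t ↦ (bsplineDensity c k t).re :=
  Complex.continuous_re.comp (continuous_bsplineDensity hc hk)

/-- **FTC**: for `k ≥ 1`, `c > 0`, `bsplineCDF c k` has derivative `re(bsplineDensity c k v)` at every `v`. [folklore] -/
theorem hasDerivAt_bsplineCDF (hc : 0 < c) {k : ℕ} (hk : 1 ≤ k) (v : ℝ) :
    HasDerivAt (bsplineCDF c k) ((bsplineDensity c k v).re) v := by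
  have hcont := continuous_bsplineDensity_re hc hk
  have hint := integrable_bsplineDensity_re c k
  set a : ℝ := v - 1 with ha
  have heq : bsplineCDF c k = fun w ↦ bsplineCDF c k a + ∫ t in a..w, (bsplineDensity c k t).re := by
    funext w
    unfold bsplineCDF
    rw [← intervalIntegral.integral_Iic_sub_Iic hint.integrableOn hint.integrableOn]
    ring
  rw [heq]
  refine HasDerivAt.const_add _ ?_
  exact intervalIntegral.integral_hasDerivAt_right (hcont.intervalIntegrable _ _)
    (hcont.stronglyMeasurableAtFilter _ _) hcont.continuousAt

/-- For `k ≥ 1`, `c > 0` the CDF is continuous. -/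
theorem continuous_bsplineCDF (hc : 0 < c) {k : ℕ} (hk : 1 ≤ k) : Continuous (bsplineCDF c k) :=
  continuous_iff_continuousAt.2 fun v ↦ (hasDerivAt_bsplineCDF hc hk v).continuousAt

/-- `deriv (bsplineCDF c k) v = re ρ_k(v)` (`k ≥ 1`, `c > 0`). -/
theorem deriv_bsplineCDF (hc : 0 < c) {k : ℕ} (hk : 1 ≤ k) (v : ℝ) :
    deriv (bsplineCDF c k) v = (bsplineDensity c k v).re :=
  (hasDerivAt_bsplineCDF hc hk v).deriv

/-- **Lipschitz bound of the CDF**: `|F(w) − F(v)| ≤ (2c)⁻¹·|w − v|` (`k ≥ 1`, `c > 0`; mean value theorem with `0 ≤ F′ ≤ (2c)⁻¹`). -/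
theorem abs_bsplineCDF_sub_le (hc : 0 < c) {k : ℕ} (hk : 1 ≤ k) (v w : ℝ) :
    |bsplineCDF c k w - bsplineCDF c k v| ≤ (2 * c)⁻¹ * |w - v| := by
  have hderiv : ∀ x, HasDerivAt (bsplineCDF c k) ((bsplineDensity c k x).re) x := hasDerivAt_bsplineCDF hc hk
  have hbound : ∀ x, ‖(bsplineDensity c k x).re‖ ≤ (2 * c)⁻¹ := fun x ↦ by
    rw [Real.norm_of_nonneg (bsplineDensity_re_nonneg hc.le k x)]; exact bsplineDensity_re_le hc k x
  have h := Convex.norm_image_sub_le_of_norm_hasDerivWithin_le (s := Set.univ)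
    (fun x _ ↦ (hderiv x).hasDerivWithinAt) (fun x _ ↦ hbound x) convex_univ (mem_univ v) (mem_univ w)
  rw [Real.norm_eq_abs, Real.norm_eq_abs] at h
  exact h

end Summit.RiemannHypothesis.RiemannHypothesis.Theorems.WeilColumn.ThetaMellin

end
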